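import Summits.Schanuel.Schanuel.Theorems.RootDecomp1KGapCell08

/-!
# RootDecomp1KGapCell — lens 1, generation 42 «GAP CELL / INTERLACED SPECIALISATION» (lane K-R26 (α-loc)): the walls (1, ℓ_b, ρ), (1, ℓ₂, ℓ₃, ρ) (mod hNW), their π-twins and the 31077 pair (ℓ_b, ρ) HYPOTHESIS-FREE for every ρ ∈ `FactorialGapLiouville` — located order data strictly below the log-log floor; member ρ_W — continuation (RootDecomp1KGapCell09): §9 both location bounds load-bearing, ℓ_b² not gap-Liouville + §10 prefix (four-scale helpers)

(lens-1 g42 `GapCell.lean` EDITION 3 [HOME/decomp-schanuel-lens-1/g42/ sha256 6f7828b1…, 2470 l; VERDICT L2004, EDITIONS 2+3 L2018, ACK L2023]; port by census-1 gen 17 as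
`RootDecomp1KGapCell01`–`10` — see the PORT NOTE of part 01; `--supports stmt-Schanuel-33364` (04: `stmt-Schanuel-31077`); rung 0.)
-/

open Summit.Schanuel.Schanuel.Theorems.RootDecomp1KHyper
open Summit.Schanuel.Schanuel.Theorems.RootDecomp1KHyper.HyperCell
open Summit.Schanuel.Schanuel.Theorems.RootDecomp1KRelLiouvilleCell
open Summit.Schanuel.Schanuel.Theorems.RootDecomp1KLogLogCell
open Summit.Schanuel.Schanuel.Theorems.RootDecomp1KTwoBaseCell
open LiouvilleNumber
open scoped Nat

namespace Summit.Schanuel.Schanuel.Theorems.RootDecomp1KGapCell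

variable {k n : ℕ}

/-- Upper bound for the tail in base `m ≥ 2`: `r_k ≤ 2·m^{-(k+1)!}` (tree twin: TwoBaseCell04 `remainder_le`). -/
private theorem remainder_le'' {m : ℝ} (hm : 2 ≤ m) (k : ℕ) : remainder m k ≤ 2 / m ^ (k + 1)! := by
  have m1 : (1 : ℝ) < m := by linarith
  have h := remainder_lt' k m1
  have hhalf : (1 : ℝ) / m ≤ 1 / 2 := one_div_le_one_div_of_le two_pos hm
  have hpos : (0 : ℝ) < 1 - 1 / m := by linarith
  have hinv : (1 - 1 / m)⁻¹ ≤ 2 := by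
    rw [inv_le_comm₀ hpos two_pos]
    linarith
  have hmk : (0 : ℝ) < 1 / m ^ (k + 1)! := by positivity
  calc remainder m k ≤ (1 - 1 / m)⁻¹ * (1 / m ^ (k + 1)!) := h.le
    _ ≤ 2 * (1 / m ^ (k + 1)!) := mul_le_mul_of_nonneg_right hinv hmk.le
    _ = 2 / m ^ (k + 1)! := by ring

/-! ## §9. BOTH LOCATION BOUNDS ARE LOAD-BEARING (checklist K-g42 (6)) — and `ℓ_b²` is PROVABLY NOT gap-Liouville

The two ONE-SIDED mutations of the class (upper gap bound dropped / lower gap bound dropped) BOTH contain `ℓ_b²`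
(approximants `s_M²`, exact denominators `b^{2·M!}`), while `(ℓ_b², ℓ_b)` is algebraically DEPENDENT: so neither
mutation can replace `FactorialGapLiouville` in the engine / in `algebraicIndependent_gapBlock`.  Conversely the
engine REFUTES `FactorialGapLiouville (ℓ_b²)`: the class excludes the obstruction `ρ = ℓ_b²` by THEOREM, not by fiat. -/

/-- Mutation 1: the LOWER gap bound only (upper bound dropped). -/
def GapLowerOnly (ρ : ℝ) : Prop :=
  ∀ A K : ℕ, ∃ N : ℕ, K ≤ N ∧ ∃ r : ℚ, (2 : ℝ) ^ (A * N !) < r.den ∧ |ρ - r| < 1 / (r.den : ℝ) ^ A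

/-- Mutation 2: the UPPER gap bound only (lower bound dropped). -/
def GapUpperOnly (ρ : ℝ) : Prop :=
  ∀ A K : ℕ, ∃ N : ℕ, K ≤ N ∧ ∃ r : ℚ, (r.den : ℝ) ^ A < (2 : ℝ) ^ (N + 1)! ∧ |ρ - r| < 1 / (r.den : ℝ) ^ A

/-- `GapLowerOnly ρ`. -/
theorem FactorialGapLiouville.gapLowerOnly {ρ : ℝ} (h : FactorialGapLiouville ρ) : GapLowerOnly ρ := by
  intro A K
  obtain ⟨N, hKN, r, h1, -, h3⟩ := h A K
  exact ⟨N, hKN, r, h1, h3⟩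

/-- `GapUpperOnly ρ`. -/
theorem FactorialGapLiouville.gapUpperOnly {ρ : ℝ} (h : FactorialGapLiouville ρ) : GapUpperOnly ρ := by
  intro A K
  obtain ⟨N, hKN, r, -, h2, h3⟩ := h A K
  exact ⟨N, hKN, r, h2, h3⟩

/-- The square approximant `s_M²` of `ℓ_b²` as a rational number. -/
def sqApprox (b M : ℕ) : ℚ := ((psNumer b M : ℚ) ^ 2) / (b : ℚ) ^ (2 * M !)

/-- `((sqApprox b M : ℚ) : ℝ) = partialSum (b : ℝ) M ^ 2`. -/
theorem sqApprox_cast {b : ℕ} (hb : 0 < b) (M : ℕ) :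
    ((sqApprox b M : ℚ) : ℝ) = partialSum (b : ℝ) M ^ 2 := by
  rw [partialSum_eq_psNumer_div hb, div_pow, ← pow_mul, mul_comm (M !) 2]
  unfold sqApprox; push_cast; rfl

/-- EXACT denominator `b^{2·M!}` (`M ≥ 2`: the numerator `psNumer b M ≡ 1 (mod b)`). -/
theorem sqApprox_den {b : ℕ} (hb : 2 ≤ b) {M : ℕ} (hM : 2 ≤ M) : (sqApprox b M).den = b ^ (2 * M !) := by
  have hcop : Nat.Coprime (((psNumer b M : ℤ) ^ 2)).natAbs (((b : ℤ) ^ (2 * M !))).natAbs := by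
    rw [Int.natAbs_pow, Int.natAbs_natCast, Int.natAbs_pow, Int.natAbs_natCast]
    exact ((coprime_psNumer b hM).pow_left 2).pow_right _
  have hb0 : (0 : ℤ) < (b : ℤ) ^ (2 * M !) := by positivity
  have h := Rat.den_div_eq_of_coprime (a := (psNumer b M : ℤ) ^ 2) (b := (b : ℤ) ^ (2 * M !)) hb0 hcop
  have e : ((((psNumer b M : ℤ) ^ 2 : ℤ) : ℚ) / (((b : ℤ) ^ (2 * M !) : ℤ) : ℚ)) = sqApprox b M := by
    unfold sqApprox; push_cast; rfl
  rw [e] at h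
  exact_mod_cast h

/-- `0 < ℓ_b² − s_M² < 8 / b^{(M+1)!}`. -/
private theorem liouvilleNumber_sq_sub_sqApprox {b : ℕ} (hb : 2 ≤ b) (M : ℕ) :
    0 < liouvilleNumber (b : ℝ) ^ 2 - partialSum (b : ℝ) M ^ 2 ∧
      liouvilleNumber (b : ℝ) ^ 2 - partialSum (b : ℝ) M ^ 2 < 8 / (b : ℝ) ^ (M + 1)! := by
  have hbR : (2 : ℝ) ≤ b := by exact_mod_cast hb
  have hb1 : (1 : ℝ) < b := by linarith
  have hsum := partialSum_add_remainder hb1 M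
  have hrem := remainder_pos hb1 M
  have hremle := remainder_le'' hbR M
  have hs0 : 0 ≤ partialSum (b : ℝ) M := by
    unfold partialSum; exact Finset.sum_nonneg fun i _ => by positivity
  have hs2 := partialSum_lt_two hbR M
  have hl := liouvilleNumber_le hbR
  have hfac : liouvilleNumber (b : ℝ) ^ 2 - partialSum (b : ℝ) M ^ 2 =
      remainder (b : ℝ) M * (liouvilleNumber (b : ℝ) + partialSum (b : ℝ) M) := by
    rw [← hsum]; ring
  rw [hfac]
  have hpos : 0 < liouvilleNumber (b : ℝ) + partialSum (b : ℝ) M := by rw [← hsum]; linarith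
  refine ⟨mul_pos hrem hpos, ?_⟩
  have hlt4 : liouvilleNumber (b : ℝ) + partialSum (b : ℝ) M < 4 := by linarith
  have hden : (0 : ℝ) < (b : ℝ) ^ (M + 1)! := by positivity
  calc remainder (b : ℝ) M * (liouvilleNumber (b : ℝ) + partialSum (b : ℝ) M)
      < 2 / (b : ℝ) ^ (M + 1)! * 4 := by
        apply mul_lt_mul' hremle hlt4 hpos.le (by positivity)
    _ = 8 / (b : ℝ) ^ (M + 1)! := by ring

/-- Quality of `s_M²` against the exact denominator: `|ℓ_b² − s_M²| < 1 / (b^{2M!})^A` once `M ≥ 2A + 3`. -/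
theorem liouvilleNumber_sq_quality {b : ℕ} (hb : 2 ≤ b) {A M : ℕ} (hM : 2 * A + 3 ≤ M) :
    |liouvilleNumber (b : ℝ) ^ 2 - (sqApprox b M : ℝ)| < 1 / ((sqApprox b M).den : ℝ) ^ A := by
  have hb0 : 0 < b := by omega
  have hbR : (2 : ℝ) ≤ b := by exact_mod_cast hb
  obtain ⟨hpos, hlt⟩ := liouvilleNumber_sq_sub_sqApprox hb M
  rw [sqApprox_cast hb0, abs_of_pos hpos, sqApprox_den hb (by omega)]
  push_cast
  rw [← pow_mul]
  refine hlt.trans_le ?_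
  -- `8 / b^{(M+1)!} ≤ 1 / b^{2M!·A}`  ⟸  `8 · b^{2M!A} ≤ b^{(M+1)!}`  ⟸  `b^{2M!A + 3} ≤ b^{(M+1)!}`
  have hexp : 2 * M ! * A + 3 ≤ (M + 1)! := by
    rw [Nat.factorial_succ]
    have hM1 : 2 * A + 1 + 2 ≤ M + 1 := by omega
    have hfac2 : 2 ≤ M ! := le_trans (by omega : 2 ≤ M) (Nat.self_le_factorial M)
    nlinarith
  have h8 : (8 : ℝ) ≤ (b : ℝ) ^ 3 := by
    calc (8 : ℝ) = 2 ^ 3 := by norm_num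
      _ ≤ (b : ℝ) ^ 3 := pow_le_pow_left₀ (by norm_num) hbR 3
  have hbpos : (0 : ℝ) < b := by linarith
  rw [div_le_div_iff₀ (by positivity) (by positivity), one_mul]
  calc 8 * (b : ℝ) ^ (2 * M ! * A) ≤ (b : ℝ) ^ 3 * (b : ℝ) ^ (2 * M ! * A) := by
        apply mul_le_mul_of_nonneg_right h8 (by positivity)
    _ = (b : ℝ) ^ (2 * M ! * A + 3) := by ring
    _ ≤ (b : ℝ) ^ (M + 1)! := pow_le_pow_right₀ (by linarith) hexp

/-- `ℓ_b²` lies in mutation 1 (lower bound only): scale `N := K`, approximant `s_M²` with `M ≫ A·K!`. -/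
theorem liouvilleNumber_sq_gapLowerOnly {b : ℕ} (hb : 2 ≤ b) : GapLowerOnly (liouvilleNumber (b : ℝ) ^ 2) := by
  intro A K
  set M : ℕ := A * K ! + 2 * A + 3 with hM
  refine ⟨K, le_rfl, sqApprox b M, ?_, liouvilleNumber_sq_quality hb (by omega)⟩
  rw [sqApprox_den hb (by omega)]; push_cast
  have hbR : (2 : ℝ) ≤ b := by exact_mod_cast hb
  have hMf : M ≤ M ! := Nat.self_le_factorial M
  calc (2 : ℝ) ^ (A * K !) < (2 : ℝ) ^ (2 * M !) := pow_lt_pow_right₀ (by norm_num) (by nlinarith)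
    _ ≤ (b : ℝ) ^ (2 * M !) := pow_le_pow_left₀ (by norm_num) hbR _

/-- `ℓ_b²` lies in mutation 2 (upper bound only): approximant `s_M²` with `M = K + 2A + 3`, scale `N ≫ b·A·M!`. -/
theorem liouvilleNumber_sq_gapUpperOnly {b : ℕ} (hb : 2 ≤ b) : GapUpperOnly (liouvilleNumber (b : ℝ) ^ 2) := by
  intro A K
  set M : ℕ := K + 2 * A + 3 with hM
  set N : ℕ := K + 2 * b * (M ! * A) with hN
  refine ⟨N, by omega, sqApprox b M, ?_, liouvilleNumber_sq_quality hb (by omega)⟩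
  rw [sqApprox_den hb (by omega)]; push_cast
  rw [← pow_mul]
  have hb2 : (b : ℝ) ≤ (2 : ℝ) ^ b := by exact_mod_cast (Nat.lt_two_pow_self).le
  have hNf : N + 1 ≤ (N + 1)! := Nat.self_le_factorial _
  calc (b : ℝ) ^ (2 * M ! * A) ≤ ((2 : ℝ) ^ b) ^ (2 * M ! * A) := pow_le_pow_left₀ (by positivity) hb2 _
    _ = (2 : ℝ) ^ (b * (2 * M ! * A)) := by rw [← pow_mul]
    _ < (2 : ℝ) ^ (N + 1)! := pow_lt_pow_right₀ (by norm_num) (by nlinarith)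

/-- `(x², x)` is algebraically dependent (the relation `X₀ − X₁²`). -/
private theorem not_algebraicIndependent_sq_pair (x : ℂ) : ¬ AlgebraicIndependent ℚ ![x ^ 2, x] := by
  intro h
  have h0 := (algebraicIndependent_iff.mp h)
    (MvPolynomial.X 0 - MvPolynomial.X 1 ^ 2 : MvPolynomial (Fin 2) ℚ) (by simp)
  have h1 := congr_arg (MvPolynomial.eval ![(1 : ℚ), 0]) h0
  simp at h1

/-- **`ℓ_b²` IS NOT GAP-LIOUVILLE** — refuted by the engine itself (else `(ℓ_b², ℓ_b)` would be algebraically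
independent). The class excludes the obstruction by THEOREM. -/
theorem not_factorialGapLiouville_liouvilleNumber_sq {b : ℕ} (hb : 2 ≤ b) :
    ¬ FactorialGapLiouville (liouvilleNumber (b : ℝ) ^ 2) := by
  intro hρ
  have h := algebraicIndependent_gapBlock (b := ![b]) (fun i => by fin_cases i; exact hb)
    (wt_injective_single hb) hρ
  have e : (Fin.cons (((liouvilleNumber (b : ℝ) ^ 2 : ℝ) : ℂ)) (fun i => ((liouvilleNumber ((![b] i : ℕ) : ℝ) : ℝ) : ℂ))
      : Fin (1 + 1) → ℂ) = ![((liouvilleNumber (b : ℝ) : ℝ) : ℂ) ^ 2, ((liouvilleNumber (b : ℝ) : ℝ) : ℂ)] := by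
    funext i; fin_cases i
    · simp
    · rfl
  rw [e] at h
  exact not_algebraicIndependent_sq_pair _ h

/-- **CHECKLIST K-g42 (6), TYPED.**  Both one-sided mutations of the class contain `ℓ_b²`; `(ℓ_b², ℓ_b)` is
algebraically dependent; `ℓ_b²` is not gap-Liouville.  Hence the LOWER bound (the rational-root lever) and the
UPPER bound (the block's tail budget) are each load-bearing: neither mutation can replace the class in
`algebraicIndependent_gapBlock` (its conclusion is FALSE at `ρ = ℓ_b²`). -/
theorem location_bounds_load_bearing {b : ℕ} (hb : 2 ≤ b) :
    GapLowerOnly (liouvilleNumber (b : ℝ) ^ 2) ∧ GapUpperOnly (liouvilleNumber (b : ℝ) ^ 2) ∧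
    ¬ AlgebraicIndependent ℚ ![((liouvilleNumber (b : ℝ) : ℝ) : ℂ) ^ 2, ((liouvilleNumber (b : ℝ) : ℝ) : ℂ)] ∧
    ¬ FactorialGapLiouville (liouvilleNumber (b : ℝ) ^ 2) ∧
    (∀ ρ : ℝ, FactorialGapLiouville ρ → GapLowerOnly ρ ∧ GapUpperOnly ρ) :=
  ⟨liouvilleNumber_sq_gapLowerOnly hb, liouvilleNumber_sq_gapUpperOnly hb, not_algebraicIndependent_sq_pair _,
    not_factorialGapLiouville_liouvilleNumber_sq hb, fun _ h => ⟨h.gapLowerOnly, h.gapUpperOnly⟩⟩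

/-! ## §10 (EDITION 2)  NO HYPER-SMALL FORMS IN `(1, ℓ₂, ℓ₃, ρ_W)` — TWO RADICES, THREE INTERLACED CUTS
(hypothesis-free); the wall-4 member `z_G = (1, ℓ₂, ℓ₃, ρ_W)` IS IN THE SCOPE OF ITEM 33364 (all three binders)
and the item is DECIDED there (mod `hNW`; at the π-twin HYPOTHESIS-FREE)

Cuts `(K, M)`: `ℓ₂` AND `ℓ₃` are truncated at the SAME index `K` (common denominator `2^{K!} 3^{K!}`, as in the
tree's two-scale bound for `(1, ℓ₂, ℓ₃)`, TwoBaseCell07), `ρ_W` at `M` (denominator `2^{c_M}`); a non-zero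
truncation is `≥ 1/(2^e 3^{K!})` with `e = max(K!, c_M)`.  The three cuts `(N, N)`, `(N+1, N)`, `(N+1, N+1)` have
resolutions `2^{−c_N} 3^{−N!}`, `6^{−(N+1)!}`, `2^{−c_{N+1}} 3^{−(N+1)!}`; the interlacing `c_N + 3·N! ≤ (N+1)!`
(`N ≥ 6`) and `4·(N+1)! ≤ c_{N+1}` put every truncation error below HALF the cut's resolution once
`16 H ≤ 2^{N!}`; if all three truncations vanish then `g₃ = 0` (last difference `g₃ · 2^{−c_{N+1}}`) and
`g₁ 3^{(N+1)!} + g₂ 2^{(N+1)!} = 0`, whence `g₁ = g₂ = 0` by coprimality and `|g₁| < 2^{(N+1)!}` (the tree's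
two-scale step).  Result: `exp(−(1+Σ|gᵢ|)^20) ≤ |g₀ + g₁ℓ₂ + g₂ℓ₃ + g₃ρ_W|` for every `g ≠ 0`. -/

section FourScales

/-- `⌊√N⌋ + 4 ≤ N` for `N ≥ 6`. -/
private theorem sqrt_add_four_le {N : ℕ} (hN : 6 ≤ N) : Nat.sqrt N + 4 ≤ N := by
  obtain ⟨M, rfl⟩ : ∃ M, N = M + 3 := ⟨N - 3, by omega⟩
  have hM : 3 ≤ M := by omega
  have h : Nat.sqrt (M + 3) < M := Nat.sqrt_lt'.mpr (by nlinarith)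
  omega

/-- Interlacing, III: `c_N + 3·N! ≤ (N+1)!` (`N ≥ 6`). -/
theorem cW_add_three_mul_factorial_le {N : ℕ} (hN : 6 ≤ N) : cW N + 3 * N ! ≤ (N + 1)! := by
  unfold cW
  rw [Nat.factorial_succ]
  have := sqrt_add_four_le hN
  calc N ! * (Nat.sqrt N + 2) + 3 * N ! = (Nat.sqrt N + 5) * N ! := by ring
    _ ≤ (N + 1) * N ! := Nat.mul_le_mul_right _ (by omega)

/-- Interlacing, IV: `4·N! ≤ c_N` (`N ≥ 4`). -/
theorem four_mul_factorial_le_cW {N : ℕ} (hN : 4 ≤ N) : 4 * N ! ≤ cW N := by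
  unfold cW
  have hs : 2 ≤ Nat.sqrt N := Nat.le_sqrt'.mpr (by nlinarith)
  rw [Nat.mul_comm]
  exact Nat.mul_le_mul_left _ (by omega)

/-- Approximation of the four-term form by its truncation at cut `(K, M)` (`ℓ₂, ℓ₃` both cut at `K`). -/
private theorem formG4_approx (g : Fin 4 → ℤ) (K M : ℕ) :
    |((g 0 : ℝ) + g 1 * liouvilleNumber 2 + g 2 * liouvilleNumber 3 + g 3 * rhoW) -
      ((g 0 : ℝ) + g 1 * partialSum 2 K + g 2 * partialSum 3 K + g 3 * tW M)| ≤
      (|(g 1 : ℝ)| + |(g 2 : ℝ)|) * (2 / 2 ^ (K + 1)!) + |(g 3 : ℝ)| * (2 / (2 : ℝ) ^ cW (M + 1)) := by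
  have h2 := partialSum_add_remainder (by norm_num : (1 : ℝ) < 2) K
  have h3 := partialSum_add_remainder (by norm_num : (1 : ℝ) < 3) K
  have hW := rhoW_eq_tW_add M
  have r2le : remainder 2 K ≤ 2 / 2 ^ (K + 1)! := remainder_le'' (by norm_num) K
  have r3le : remainder 3 K ≤ 2 / 2 ^ (K + 1)! := by
    refine (remainder_le'' (by norm_num) K).trans ?_
    gcongr; norm_num
  have r2pos := remainder_pos (by norm_num : (1 : ℝ) < 2) K
  have r3pos := remainder_pos (by norm_num : (1 : ℝ) < 3) K
  have tle := tailW_le M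
  have tpos := tailW_pos M
  have e : ((g 0 : ℝ) + g 1 * liouvilleNumber 2 + g 2 * liouvilleNumber 3 + g 3 * rhoW) -
      ((g 0 : ℝ) + g 1 * partialSum 2 K + g 2 * partialSum 3 K + g 3 * tW M) =
      g 1 * remainder 2 K + g 2 * remainder 3 K + g 3 * ∑' j, aW (j + (M + 1)) := by
    rw [← h2, ← h3, hW]; ring
  rw [e]
  calc |(g 1 : ℝ) * remainder 2 K + g 2 * remainder 3 K + g 3 * ∑' j, aW (j + (M + 1))|
      ≤ |(g 1 : ℝ)| * remainder 2 K + |(g 2 : ℝ)| * remainder 3 K +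
          |(g 3 : ℝ)| * ∑' j, aW (j + (M + 1)) := by
        refine (abs_add_le _ _).trans (add_le_add ((abs_add_le _ _).trans ?_) ?_)
        · rw [abs_mul, abs_mul, abs_of_pos r2pos, abs_of_pos r3pos]
        · rw [abs_mul, abs_of_pos tpos]
    _ ≤ |(g 1 : ℝ)| * (2 / 2 ^ (K + 1)!) + |(g 2 : ℝ)| * (2 / 2 ^ (K + 1)!) +
          |(g 3 : ℝ)| * (2 / (2 : ℝ) ^ cW (M + 1)) := by gcongr
    _ = (|(g 1 : ℝ)| + |(g 2 : ℝ)|) * (2 / 2 ^ (K + 1)!) + |(g 3 : ℝ)| * (2 / (2 : ℝ) ^ cW (M + 1)) := by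
        ring

/-- Scale lower bound at cut `(K, M)`: a NON-ZERO truncation is `≥ 1/(2^e · 3^{K!})` whenever `K! ≤ e` and
`c_M ≤ e` (TWO radices: common denominator `2^e 3^{K!}`). -/
private theorem formG4_scale_lower (g : Fin 4 → ℤ) {K M e : ℕ} (hK : K ! ≤ e) (hM : cW M ≤ e)
    (hne : (g 0 : ℝ) + g 1 * partialSum 2 K + g 2 * partialSum 3 K + g 3 * tW M ≠ 0) :
    1 / ((2 : ℝ) ^ e * 3 ^ K !) ≤ |(g 0 : ℝ) + g 1 * partialSum 2 K + g 2 * partialSum 3 K + g 3 * tW M| := by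
  have hp2 : partialSum 2 K = (psNumer 2 K : ℝ) / 2 ^ K ! := by
    have := partialSum_eq_psNumer_div (by norm_num : 0 < 2) K
    push_cast at this
    exact this
  have hp3 : partialSum 3 K = (psNumer 3 K : ℝ) / 3 ^ K ! := by
    have := partialSum_eq_psNumer_div (by norm_num : 0 < 3) K
    push_cast at this
    exact this
  set I : ℤ := g 0 * 2 ^ e * 3 ^ K ! + g 1 * (psNumer 2 K) * 2 ^ (e - K !) * 3 ^ K ! +
    g 2 * (psNumer 3 K) * 2 ^ e + g 3 * (MW M) * 2 ^ (e - cW M) * 3 ^ K ! with hI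
  have hΦ : (g 0 : ℝ) + g 1 * partialSum 2 K + g 2 * partialSum 3 K + g 3 * tW M =
      (I : ℝ) / (2 ^ e * 3 ^ K !) := by
    rw [hp2, hp3, tW_eq, hI]
    push_cast
    rw [pow_sub₀ _ (two_ne_zero) hK, pow_sub₀ _ (two_ne_zero) hM]
    field_simp
  rw [hΦ] at hne ⊢
  have hI0 : I ≠ 0 := by
    intro h0; apply hne; rw [h0]; simp
  have hI1 : (1 : ℝ) ≤ |(I : ℝ)| := by exact_mod_cast Int.one_le_abs hI0
  rw [abs_div, abs_of_pos (by positivity : (0 : ℝ) < 2 ^ e * 3 ^ K !)]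
  exact div_le_div_of_nonneg_right hI1 (by positivity)

end FourScales

end Summit.Schanuel.Schanuel.Theorems.RootDecomp1KGapCell
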